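/-
  Summits/AtomisticToContinuum/Crystallization/Theorems/OverbindingBudgetAffineFarCoreLattice.lean

  residual stmt-AtomisticToContinuum-31280 · slot Z `FarAggregatePricing 12 (1/25) (1/2000) (1/(2·10⁷))` · leaf LAB₁′ `ShelteredShellLabelling'`
  (leaf list v14′, critic rows 890/899; engine LAB₁′ ⟸ R_aff′ ∧ BBI₀ ∧ CORE): tool-box for CORE `CoreRechart (1/25)`, part 1 —
  lattice arithmetic of a close-packed stacking at Hales's scale, the DUAL GAP, the COVERING CONSTANT of the twelve contact directions, the
  INWARD NEIGHBOUR under a `12 %`-distorted metric, and an operator bound from a net.  decomp-a2c lens-4 «minimal counterexample / extremal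
  reduction», generation 58.  Imports K1 `…FarFrameLattice` + Literature only.  0 sorry · 0 axiom · no instance · no notation · no option.
-/
import Summits.AtomisticToContinuum.Crystallization.Theorems.OverbindingBudgetAffineFarFrameLattice
import Literature.MathematicalPhysics.StatisticalMechanics.BarlowRings
import Literature.MathematicalPhysics.StatisticalMechanics.BarlowCovering
import Mathlib.Analysis.InnerProductSpace.Adjoint

/-! # CORE tool-box 1: frame lattice products, dual gap, covering constant, inward neighbour, net bound (PROVED)

* §1 Every point of Hales's stacking `barlowStacking 2 𝗁 s` lies in the frame lattice `Λ = ℤu₁ + ℤw + ℤ𝗁e₃` (`IsFrameInt`, K1), and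
  `⟪Λ, Λ⟫ ⊆ (2/3)ℤ` (`IsFrameInt.inner_mem`).
* §2 DUAL GAP.  A vector `w` with `⟪w, U e⟫ ∈ (2/3)ℤ` for every `e` of a layer shell (`U` a linear isometry) and `‖w‖ < 1/3` vanishes.
* §3 COVERING CONSTANT.  For every `d ∈ ℝ³` some vector `e` of `layerShell σ τ` has `⟪d, e⟫ ≤ −(47/40)‖d‖` (hexagon: `√3/2`; hole triples:
  the height `𝗁`; true constant `√2`).
* §4 INWARD NEIGHBOUR.  If `B` is `12 %`-close to an isometry and `‖x‖² ≥ 2`, some contact direction `e ∈ barlowShell σ τ` has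
  `‖B (x + e)‖ < ‖B x‖` — the descent step of the minimal-counterexample argument of CORE.
* §5 NET BOUND.  A linear map bounded by `δ` on a `ρ`-net of the ball of radius `r > ρ` has norm `≤ δ/(r − ρ)` on unit vectors.
-/

namespace Summit.AtomisticToContinuum.Crystallization.Theorems.OverbindingBudgetAffineFarSmoothSplit

open scoped BigOperators RealInnerProductSpace
open Literature.MathematicalPhysics.StatisticalMechanics
open Literature.Geometry.DiscreteGeometry (layerSpacing layerSpacing_sq layerSpacing_pos layerShell hexagonSet holeTriple
  mem_layerShell_iff hexagonSet_subset_layerShell mem_holeTriple_iff mem_holeTriple_one_iff frameW_eq inner_fin3 norm_sq_fin3 sqrt_three_sq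
  frameU_apply_zero frameU_apply_one frameU_apply_two frameV_apply_zero frameV_apply_one frameV_apply_two frameW_apply_zero
  frameW_apply_one frameW_apply_two frameE_apply_zero frameE_apply_one frameE_apply_two
  inner_frameU_frameU inner_frameV_frameV inner_frameU_frameV inner_frameV_frameU inner_frameU_frameE inner_frameE_frameU
  inner_frameV_frameE inner_frameE_frameV inner_frameE_frameE inner_frameW_frameU inner_frameU_frameW inner_frameW_frameV
  inner_frameV_frameW inner_frameW_frameW inner_frameW_frameE inner_frameE_frameW)

/-! ## §1  Hales's stacking lies in the frame lattice; lattice inner products are in `(2/3)ℤ` (PROVED) -/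

/-- `Λ` is closed under negation. [this file] -/
theorem IsFrameInt.neg {x : EuclideanSpace ℝ (Fin 3)} (hx : IsFrameInt x) : IsFrameInt (-x) := by
  have h := hx.smul_of_eq_intCast (c := -1) ⟨-1, by norm_num⟩
  rwa [neg_one_smul] at h

/-- `Λ` is closed under subtraction. [this file] -/
theorem IsFrameInt.sub {x y : EuclideanSpace ℝ (Fin 3)} (hx : IsFrameInt x) (hy : IsFrameInt y) : IsFrameInt (x - y) := by
  rw [sub_eq_add_neg]; exact hx.add hy.neg

/-- **Every point of Hales's stacking is a frame-lattice vector**: `i u₁ + j u₂ + L w + k 𝗁e₃ = (i − j) u₁ + (3j + L) w + k 𝗁e₃`. [this file] -/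
theorem isFrameInt_barlowPos_two (s : ℤ → ℤ) (k i j : ℤ) : IsFrameInt (barlowPos 2 layerSpacing s k i j) :=
  ⟨i - j, 3 * j + haggLabel s k, k, by rw [barlowPos, frameV_eq_smul_frameW_sub]; push_cast; module⟩

/-- Doubled points of the unit-spacing stacking are frame-lattice vectors. [this file] -/
theorem isFrameInt_two_smul_of_mem {s : ℤ → ℤ} {q : EuclideanSpace ℝ (Fin 3)} (hq : q ∈ barlowStacking 1 (Real.sqrt (2 / 3)) s) :
    IsFrameInt ((2 : ℝ) • q) := by
  obtain ⟨k, i, j, rfl⟩ := hq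
  rw [← barlowPos_two_layerSpacing]
  exact isFrameInt_barlowPos_two s k i j

/-- Doubled differences of points of the unit-spacing stacking are frame-lattice vectors. [this file] -/
theorem isFrameInt_two_smul_sub {s : ℤ → ℤ} {q q' : EuclideanSpace ℝ (Fin 3)} (hq : q ∈ barlowStacking 1 (Real.sqrt (2 / 3)) s)
    (hq' : q' ∈ barlowStacking 1 (Real.sqrt (2 / 3)) s) : IsFrameInt ((2 : ℝ) • (q - q')) := by
  rw [smul_sub]; exact (isFrameInt_two_smul_of_mem hq).sub (isFrameInt_two_smul_of_mem hq')

/-- **`⟪Λ, Λ⟫ ⊆ (2/3)ℤ`**: the Gram form `4mm' + 2mn' + 2nm' + (4/3)nn' + (8/3)kk'` is `2/3` times an integer. [this file] -/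
theorem IsFrameInt.inner_mem {x y : EuclideanSpace ℝ (Fin 3)} (hx : IsFrameInt x) (hy : IsFrameInt y) :
    ∃ n : ℤ, ⟪x, y⟫ = 2 / 3 * n := by
  obtain ⟨m, n, k, rfl⟩ := hx
  obtain ⟨m', n', k', rfl⟩ := hy
  refine ⟨6 * m * m' + 3 * m * n' + 3 * n * m' + 2 * n * n' + 4 * k * k', ?_⟩
  rw [inner_uweCombo]; push_cast; ring

/-- A real number of the form `(2/3)·n`, `n ∈ ℤ`, with absolute value `< 2/3` is `0`. [folklore] -/
theorem eq_zero_of_two_thirds_mul {t : ℝ} {n : ℤ} (ht : t = 2 / 3 * n) (hlt : |t| < 2 / 3) : t = 0 := by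
  have hn : |(n : ℝ)| < 1 := by
    rw [ht, abs_mul, abs_of_pos (by norm_num : (0 : ℝ) < 2 / 3)] at hlt
    linarith
  have hn0 : n = 0 := by
    have h1 : |n| < 1 := by exact_mod_cast hn
    exact Int.abs_lt_one_iff.mp h1
  rw [ht, hn0]; simp

/-! ## §2  The dual gap (PROVED) -/

/-- Linear isometries of `ℝ³` are surjective (upgrade to an equivalence). [folklore] -/
theorem linearIsometry_surjective (U : EuclideanSpace ℝ (Fin 3) →ₗᵢ[ℝ] EuclideanSpace ℝ (Fin 3)) : Function.Surjective U :=
  (U.toLinearIsometryEquiv rfl).surjective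

/-- **DUAL GAP (PROVED).** If `⟪w, U e⟫ ∈ (2/3)ℤ` for every vector `e` of a layer shell `layerShell σ τ` (`U` a linear isometry) and
`‖w‖ < 1/3`, then `w = 0`: each product has absolute value `≤ 2‖w‖ < 2/3`, so vanishes, and `u₁, u₂, σw + 𝗁e₃` span `ℝ³`. [this file] -/
theorem eq_zero_of_inner_shell_mem {σ τ : ℝ} (hσ : σ = 1 ∨ σ = -1) (hτ : τ = 1 ∨ τ = -1)
    (U : EuclideanSpace ℝ (Fin 3) →ₗᵢ[ℝ] EuclideanSpace ℝ (Fin 3)) {w : EuclideanSpace ℝ (Fin 3)}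
    (h : ∀ e ∈ layerShell σ τ, ∃ n : ℤ, ⟪w, U e⟫ = 2 / 3 * n) (hw : ‖w‖ < 1 / 3) : w = 0 := by
  have zero_of : ∀ e ∈ layerShell σ τ, ⟪w, U e⟫ = 0 := by
    intro e he
    obtain ⟨n, hn⟩ := h e he
    refine eq_zero_of_two_thirds_mul hn ?_
    have h1 : |⟪w, U e⟫| ≤ ‖w‖ * ‖U e‖ := abs_real_inner_le_norm _ _
    rw [U.norm_map, norm_eq_two_of_mem_layerShell hσ hτ he] at h1
    linarith
  obtain ⟨w₀, rfl⟩ := linearIsometry_surjective U w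
  have hin : ∀ e, ⟪U w₀, U e⟫ = ⟪w₀, e⟫ := fun e => U.inner_map_map w₀ e
  have m_u : triangularVec₁ (2 : ℝ) ∈ layerShell σ τ := hexagonSet_subset_layerShell _ _ (by simp [hexagonSet])
  have m_v : triangularVec₂ (2 : ℝ) ∈ layerShell σ τ := hexagonSet_subset_layerShell _ _ (by simp [hexagonSet])
  have m_h : σ • barlowOffset (2 : ℝ) + layerNormal layerSpacing ∈ layerShell σ τ :=
    mem_layerShell_iff.2 (Or.inr (Or.inl (by rw [add_sub_cancel_right]; simp [holeTriple])))
  have e1 := zero_of _ m_u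
  have e2 := zero_of _ m_v
  have e3 := zero_of _ m_h
  rw [hin, inner_fin3] at e1 e2 e3
  simp only [frameU_apply_zero, frameU_apply_one, frameU_apply_two, frameV_apply_zero, frameV_apply_one, frameV_apply_two,
    PiLp.add_apply, PiLp.smul_apply, smul_eq_mul, frameW_apply_zero, frameW_apply_one, frameW_apply_two, frameE_apply_zero,
    frameE_apply_one, frameE_apply_two] at e1 e2 e3
  have h3 : (0 : ℝ) < Real.sqrt 3 := by positivity
  have hh := layerSpacing_pos
  have w0 : w₀ 0 = 0 := by linarith
  have w1 : w₀ 1 = 0 := by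
    rw [w0] at e2
    have : Real.sqrt 3 * w₀ 1 = 0 := by linarith
    exact (mul_eq_zero.mp this).resolve_left h3.ne'
  have w2 : w₀ 2 = 0 := by
    rw [w0, w1] at e3
    have : layerSpacing * w₀ 2 = 0 := by rcases hσ with rfl | rfl <;> linarith
    exact (mul_eq_zero.mp this).resolve_left hh.ne'
  have : w₀ = 0 := by
    ext i; fin_cases i
    · exact w0
    · exact w1
    · exact w2
  rw [this, map_zero]

/-! ## §3  The covering constant of the twelve contact directions (PROVED) -/

/-- Hexagon part: some `e ∈ {±u₁, ±u₂, ±(u₁ − u₂)}` has `⟪d, e⟫ ≤ 0` and `⟪d, e⟫² ≥ 3 (d₀² + d₁²)` (`max(|a|,|b|,|a−b|)² ≥ a² − ab + b²`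
for `a = ⟪d,u₁⟫`, `b = ⟪d,u₂⟫`). [this file] -/
theorem exists_hexagon_inner_le (d : EuclideanSpace ℝ (Fin 3)) :
    ∃ e ∈ hexagonSet, ⟪d, e⟫ ≤ 0 ∧ 3 * (d 0 ^ 2 + d 1 ^ 2) ≤ ⟪d, e⟫ ^ 2 := by
  have ha : ⟪d, triangularVec₁ (2 : ℝ)⟫ = 2 * d 0 := by rw [inner_fin3]; simp; ring
  have hb : ⟪d, triangularVec₂ (2 : ℝ)⟫ = d 0 + Real.sqrt 3 * d 1 := by rw [inner_fin3]; simp; ring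
  have h3 := sqrt_three_sq
  -- `a² − ab + b² = 3(d₀² + d₁²)`
  have key : ∀ m : ℝ, (m = 2 * d 0 ∨ m = d 0 + Real.sqrt 3 * d 1 ∨ m = (2 * d 0) - (d 0 + Real.sqrt 3 * d 1)) →
      (2 * d 0) ^ 2 - (2 * d 0) * (d 0 + Real.sqrt 3 * d 1) + (d 0 + Real.sqrt 3 * d 1) ^ 2 ≤ m ^ 2 →
      3 * (d 0 ^ 2 + d 1 ^ 2) ≤ m ^ 2 := by
    intro m _ hm; nlinarith [h3]
  -- membership of the six hexagon vectors
  have m1 : triangularVec₁ (2 : ℝ) ∈ hexagonSet := by simp [hexagonSet]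
  have m2 : -triangularVec₁ (2 : ℝ) ∈ hexagonSet := by simp [hexagonSet]
  have m3 : triangularVec₂ (2 : ℝ) ∈ hexagonSet := by simp [hexagonSet]
  have m4 : -triangularVec₂ (2 : ℝ) ∈ hexagonSet := by simp [hexagonSet]
  have m5 : triangularVec₁ (2 : ℝ) - triangularVec₂ (2 : ℝ) ∈ hexagonSet := by simp [hexagonSet]
  have m6 : triangularVec₂ (2 : ℝ) - triangularVec₁ (2 : ℝ) ∈ hexagonSet := by simp [hexagonSet]
  set a := 2 * d 0 with ha_def
  set b := d 0 + Real.sqrt 3 * d 1 with hb_def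
  -- pick the candidate of largest absolute value, with the sign making the product nonpositive
  have pick : ∀ m : ℝ, (m = a ∨ m = b ∨ m = a - b) → a ^ 2 - a * b + b ^ 2 ≤ m ^ 2 →
      ∃ e ∈ hexagonSet, ⟪d, e⟫ ≤ 0 ∧ 3 * (d 0 ^ 2 + d 1 ^ 2) ≤ ⟪d, e⟫ ^ 2 := by
    intro m hm hle
    have h3m := key m hm hle
    rcases hm with rfl | rfl | rfl
    · rcases le_total a 0 with h0 | h0
      · exact ⟨_, m1, by rw [ha]; exact h0, by rw [ha]; exact h3m⟩
      · exact ⟨_, m2, by rw [inner_neg_right, ha]; linarith, by rw [inner_neg_right, ha, neg_sq]; exact h3m⟩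
    · rcases le_total b 0 with h0 | h0
      · exact ⟨_, m3, by rw [hb]; exact h0, by rw [hb]; exact h3m⟩
      · exact ⟨_, m4, by rw [inner_neg_right, hb]; linarith, by rw [inner_neg_right, hb, neg_sq]; exact h3m⟩
    · rcases le_total (a - b) 0 with h0 | h0
      · exact ⟨_, m5, by rw [inner_sub_right, ha, hb]; exact h0, by rw [inner_sub_right, ha, hb]; exact h3m⟩
      · refine ⟨_, m6, by rw [inner_sub_right, ha, hb]; linarith, ?_⟩
        rw [inner_sub_right, ha, hb, show (b - a) ^ 2 = (a - b) ^ 2 by ring]; exact h3m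
  by_cases hab : 0 ≤ a * b
  · rcases le_total (b ^ 2) (a ^ 2) with hba | hab'
    · exact pick a (Or.inl rfl) (by nlinarith)
    · exact pick b (Or.inr (Or.inl rfl)) (by nlinarith)
  · exact pick (a - b) (Or.inr (Or.inr rfl)) (by nlinarith)

/-- Hole-triple part: some vector `e` of the upper or the lower triple of `layerShell σ τ` has `⟪d, e⟫ ≤ −𝗁 |d₂|` (the three horizontal
parts sum to `0`). [this file] -/
theorem exists_triple_inner_le {σ τ : ℝ} (hσ : σ = 1 ∨ σ = -1) (hτ : τ = 1 ∨ τ = -1) (d : EuclideanSpace ℝ (Fin 3)) :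
    ∃ e ∈ layerShell σ τ, ⟪d, e⟫ ≤ -(layerSpacing * |d 2|) := by
  have hw : ⟪d, barlowOffset (2 : ℝ)⟫ = d 0 + Real.sqrt 3 / 3 * d 1 := by rw [inner_fin3]; simp; ring
  have hu : ⟪d, triangularVec₁ (2 : ℝ)⟫ = 2 * d 0 := by rw [inner_fin3]; simp; ring
  have hv : ⟪d, triangularVec₂ (2 : ℝ)⟫ = d 0 + Real.sqrt 3 * d 1 := by rw [inner_fin3]; simp; ring
  have he : ⟪d, layerNormal layerSpacing⟫ = layerSpacing * d 2 := by rw [inner_fin3]; simp; ring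
  -- the three horizontal parts `w, w − u₁, w − u₂` have products summing to `0`
  have hsum : ⟪d, barlowOffset (2 : ℝ)⟫ + ⟪d, barlowOffset (2 : ℝ) - triangularVec₁ (2 : ℝ)⟫ +
      ⟪d, barlowOffset (2 : ℝ) - triangularVec₂ (2 : ℝ)⟫ = 0 := by
    rw [inner_sub_right, inner_sub_right, hw, hu, hv]; ring
  -- for a sign `s = ±1` some `t` of the basic triple has `s ⟪d, t⟫ ≤ 0`
  have htrip : ∀ s : ℝ, (s = 1 ∨ s = -1) → ∃ t ∈ holeTriple 1, s * ⟪d, t⟫ ≤ 0 := by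
    intro s hs
    by_cases h1 : s * ⟪d, barlowOffset (2 : ℝ)⟫ ≤ 0
    · exact ⟨_, by simp [holeTriple], h1⟩
    by_cases h2 : s * ⟪d, barlowOffset (2 : ℝ) - triangularVec₁ (2 : ℝ)⟫ ≤ 0
    · exact ⟨_, by simp [holeTriple], h2⟩
    refine ⟨barlowOffset (2 : ℝ) - triangularVec₂ (2 : ℝ), by simp [holeTriple], ?_⟩
    push Not at h1 h2
    have h0 : s * ⟪d, barlowOffset (2 : ℝ)⟫ + s * ⟪d, barlowOffset (2 : ℝ) - triangularVec₁ (2 : ℝ)⟫ +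
        s * ⟪d, barlowOffset (2 : ℝ) - triangularVec₂ (2 : ℝ)⟫ = 0 := by
      rw [← mul_add, ← mul_add, hsum, mul_zero]
    linarith
  rcases le_total 0 (d 2) with h0 | h0
  · -- `d₂ ≥ 0`: use the lower triple `τ t − 𝗁e₃`
    obtain ⟨t, ht, hle⟩ := htrip τ hτ
    refine ⟨τ • t - layerNormal layerSpacing, mem_layerShell_iff.2 (Or.inr (Or.inr ?_)), ?_⟩
    · rw [sub_add_cancel]; exact mem_holeTriple_iff.2 ⟨t, ht, rfl⟩
    · rw [inner_sub_right, real_inner_smul_right, he, abs_of_nonneg h0]; linarith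
  · -- `d₂ ≤ 0`: use the upper triple `σ t + 𝗁e₃`
    obtain ⟨t, ht, hle⟩ := htrip σ hσ
    refine ⟨σ • t + layerNormal layerSpacing, mem_layerShell_iff.2 (Or.inr (Or.inl ?_)), ?_⟩
    · rw [add_sub_cancel_right]; exact mem_holeTriple_iff.2 ⟨t, ht, rfl⟩
    · rw [inner_add_right, real_inner_smul_right, he, abs_of_nonpos h0]; linarith

/-- **COVERING CONSTANT (PROVED).** For every `d ∈ ℝ³` some vector `e ∈ layerShell σ τ` (`σ, τ = ±1`, norm `2`) has
`⟪d, e⟫ ≤ −(47/40)‖d‖` — i.e. at unit scale the twelve contact directions of a close-packed site see every direction within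
`cos⁻¹(0.5875)`. (`max(3P, 8V/3) ≥ (47/40)²(P + V)` for `P = d₀² + d₁²`, `V = d₂²`.) [this file] -/
theorem exists_layerShell_inner_le {σ τ : ℝ} (hσ : σ = 1 ∨ σ = -1) (hτ : τ = 1 ∨ τ = -1) (d : EuclideanSpace ℝ (Fin 3)) :
    ∃ e ∈ layerShell σ τ, ⟪d, e⟫ ≤ -(47 / 40 * ‖d‖) := by
  have hn : ‖d‖ ^ 2 = d 0 ^ 2 + d 1 ^ 2 + d 2 ^ 2 := norm_sq_fin3 d
  have hd : 0 ≤ ‖d‖ := norm_nonneg d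
  -- conclude from `⟪d,e⟫ ≤ 0` and `⟪d,e⟫² ≥ (47/40)² ‖d‖²`
  have concl : ∀ e : EuclideanSpace ℝ (Fin 3), ⟪d, e⟫ ≤ 0 → (47 / 40 * ‖d‖) ^ 2 ≤ ⟪d, e⟫ ^ 2 → ⟪d, e⟫ ≤ -(47 / 40 * ‖d‖) := by
    intro e h0 hsq
    nlinarith [hsq, h0, hd]
  by_cases hP : (47 / 40 : ℝ) ^ 2 * (d 0 ^ 2 + d 1 ^ 2 + d 2 ^ 2) ≤ 3 * (d 0 ^ 2 + d 1 ^ 2)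
  · obtain ⟨e, he, h0, hsq⟩ := exists_hexagon_inner_le d
    exact ⟨e, hexagonSet_subset_layerShell _ _ he, concl e h0 (by rw [mul_pow, hn]; linarith)⟩
  · obtain ⟨e, he, hle⟩ := exists_triple_inner_le hσ hτ d
    have hh := layerSpacing_sq
    have hpos := layerSpacing_pos
    have h0 : ⟪d, e⟫ ≤ 0 := by nlinarith [abs_nonneg (d 2)]
    refine ⟨e, he, concl e h0 ?_⟩
    have habs : |d 2| ^ 2 = d 2 ^ 2 := sq_abs _
    have hX : 0 ≤ layerSpacing * |d 2| := by positivity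
    have h1 : (layerSpacing * |d 2|) ^ 2 ≤ ⟪d, e⟫ ^ 2 := by
      nlinarith [mul_nonneg (by linarith : 0 ≤ -⟪d, e⟫ - layerSpacing * |d 2|) (by linarith : 0 ≤ -⟪d, e⟫ + layerSpacing * |d 2|)]
    rw [mul_pow, hn]
    push Not at hP
    nlinarith [h1, habs, hh]

/-- The covering constant at unit scale: some `e ∈ barlowShell σ τ` (norm `1`) has `⟪d, e⟫ ≤ −(47/80)‖d‖`. [this file] -/
theorem exists_barlowShell_inner_le {σ τ : ℝ} (hσ : σ = 1 ∨ σ = -1) (hτ : τ = 1 ∨ τ = -1) (d : EuclideanSpace ℝ (Fin 3)) :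
    ∃ e ∈ barlowShell σ τ, ⟪d, e⟫ ≤ -(47 / 80 * ‖d‖) := by
  obtain ⟨e, he, hle⟩ := exists_layerShell_inner_le hσ hτ d
  refine ⟨(2 : ℝ)⁻¹ • e, ⟨e, he, rfl⟩, ?_⟩
  rw [real_inner_smul_right]; linarith

/-! ## §4  The inward neighbour under a distorted metric (PROVED) -/

/-- The vector representing `e ↦ ⟪B x, B e⟫` has norm `≥ ‖B x‖²/‖x‖`. [folklore; this file] -/
theorem norm_sq_le_norm_adjoint_mul (B : EuclideanSpace ℝ (Fin 3) →ₗ[ℝ] EuclideanSpace ℝ (Fin 3)) (x : EuclideanSpace ℝ (Fin 3)) :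
    ‖B x‖ ^ 2 ≤ ‖LinearMap.adjoint B (B x)‖ * ‖x‖ := by
  have h := real_inner_le_norm (LinearMap.adjoint B (B x)) x
  rwa [LinearMap.adjoint_inner_left, real_inner_self_eq_norm_sq] at h

/-- **INWARD NEIGHBOUR (PROVED).** If `(22/25)‖v‖ ≤ ‖B v‖ ≤ (28/25)‖v‖` for all `v` (a `12 %` distortion) and `‖x‖² ≥ 2`, some contact
direction `e ∈ barlowShell σ τ` (`σ, τ = ±1`) has `‖B (x + e)‖ < ‖B x‖`: with `d = Bᵀ B x`, `‖B(x+e)‖² = ‖Bx‖² + 2⟪d,e⟫ + ‖Be‖²`,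
`⟪d, e⟫ ≤ −(47/80)‖d‖`, `‖d‖ ≥ (22/25)²‖x‖`, `‖Be‖ ≤ 28/25`, and `(47/40)(484/625)√2 > (28/25)²`. [this file] -/
theorem exists_barlowShell_norm_map_add_lt {σ τ : ℝ} (hσ : σ = 1 ∨ σ = -1) (hτ : τ = 1 ∨ τ = -1)
    (B : EuclideanSpace ℝ (Fin 3) →ₗ[ℝ] EuclideanSpace ℝ (Fin 3))
    (hlo : ∀ v, 22 / 25 * ‖v‖ ≤ ‖B v‖) (hhi : ∀ v, ‖B v‖ ≤ 28 / 25 * ‖v‖)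
    {x : EuclideanSpace ℝ (Fin 3)} (hx : 2 ≤ ‖x‖ ^ 2) :
    ∃ e ∈ barlowShell σ τ, ‖B (x + e)‖ < ‖B x‖ := by
  set d := LinearMap.adjoint B (B x) with hd
  obtain ⟨e, he, hle⟩ := exists_barlowShell_inner_le hσ hτ d
  refine ⟨e, he, ?_⟩
  have he1 : ‖e‖ = 1 := norm_eq_one_of_mem_barlowShell hσ hτ he
  have hBe : ‖B e‖ ≤ 28 / 25 := by simpa [he1] using hhi e
  have hxpos : 0 < ‖x‖ := by nlinarith [norm_nonneg x]
  have hx1 : (7 / 5 : ℝ) < ‖x‖ := by nlinarith [norm_nonneg x]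
  have hBx : 22 / 25 * ‖x‖ ≤ ‖B x‖ := hlo x
  have hdx : ‖B x‖ ^ 2 ≤ ‖d‖ * ‖x‖ := norm_sq_le_norm_adjoint_mul B x
  have hd1 : (22 / 25) ^ 2 * ‖x‖ ≤ ‖d‖ := by
    have h1 : (22 / 25 * ‖x‖) ^ 2 ≤ ‖d‖ * ‖x‖ := le_trans (pow_le_pow_left₀ (by positivity) hBx 2) hdx
    have h2 : ((22 / 25) ^ 2 * ‖x‖) * ‖x‖ ≤ ‖d‖ * ‖x‖ := by nlinarith
    exact le_of_mul_le_mul_right h2 hxpos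
  have hexp : ‖B (x + e)‖ ^ 2 = ‖B x‖ ^ 2 + 2 * ⟪d, e⟫ + ‖B e‖ ^ 2 := by
    rw [map_add, ← real_inner_self_eq_norm_sq, real_inner_add_add_self, real_inner_self_eq_norm_sq, real_inner_self_eq_norm_sq, hd,
      LinearMap.adjoint_inner_left]
  have hBe2 : ‖B e‖ ^ 2 ≤ (28 / 25) ^ 2 := pow_le_pow_left₀ (norm_nonneg _) hBe 2
  have hlt : ‖B (x + e)‖ ^ 2 < ‖B x‖ ^ 2 := by
    rw [hexp]
    linarith [hle, hd1, hBe2, hx1]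
  exact lt_of_pow_lt_pow_left₀ 2 (norm_nonneg _) hlt

/-! ## §5  An operator bound from a net (PROVED) -/

/-- **NET BOUND (PROVED).** If every point of the ball of radius `r` is within `ρ < r` of a point where the linear map `D` has norm
`≤ δ` (`δ ≥ 0`), then `‖D v‖ ≤ δ/(r − ρ) · ‖v‖` for all `v` (self-improving estimate through the operator norm). [folklore; this file] -/
theorem norm_map_le_of_net (D : EuclideanSpace ℝ (Fin 3) →ₗ[ℝ] EuclideanSpace ℝ (Fin 3)) {r ρ δ : ℝ} (hρ : 0 ≤ ρ) (hρr : ρ < r)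
    (hδ : 0 ≤ δ) (hnet : ∀ w : EuclideanSpace ℝ (Fin 3), ‖w‖ ≤ r → ∃ z, ‖z - w‖ ≤ ρ ∧ ‖D z‖ ≤ δ) (v : EuclideanSpace ℝ (Fin 3)) :
    ‖D v‖ ≤ δ / (r - ρ) * ‖v‖ := by
  have hr : 0 < r := lt_of_le_of_lt hρ hρr
  set Dc : EuclideanSpace ℝ (Fin 3) →L[ℝ] EuclideanSpace ℝ (Fin 3) := LinearMap.toContinuousLinearMap D with hDc
  have hDc_apply : ∀ u, Dc u = D u := fun u => rfl
  -- pointwise: `‖D v‖ ≤ ((δ + ‖Dc‖ ρ)/r) ‖v‖`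
  have key : ∀ u : EuclideanSpace ℝ (Fin 3), ‖Dc u‖ ≤ (δ + ‖Dc‖ * ρ) / r * ‖u‖ := by
    intro u
    by_cases hu : u = 0
    · rw [hu]; simp
    have hun : 0 < ‖u‖ := norm_pos_iff.2 hu
    set w : EuclideanSpace ℝ (Fin 3) := (r / ‖u‖) • u with hw
    have hwn : ‖w‖ = r := by rw [hw, norm_smul, Real.norm_eq_abs, abs_of_pos (by positivity), div_mul_cancel₀ _ hun.ne']
    obtain ⟨z, hz, hDz⟩ := hnet w hwn.le
    have hDw : ‖Dc w‖ ≤ δ + ‖Dc‖ * ρ := by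
      have e : Dc w = Dc z + Dc (w - z) := by rw [← map_add]; congr 1; abel
      rw [e]
      refine (norm_add_le _ _).trans (add_le_add (by rw [hDc_apply]; exact hDz) ?_)
      refine (Dc.le_opNorm _).trans (mul_le_mul_of_nonneg_left ?_ (norm_nonneg _))
      rwa [norm_sub_rev]
    have huw : u = (‖u‖ / r) • w := by
      rw [hw, smul_smul, show ‖u‖ / r * (r / ‖u‖) = 1 by field_simp, one_smul]
    calc ‖Dc u‖ = ‖u‖ / r * ‖Dc w‖ := by
          rw [huw, map_smul, norm_smul, Real.norm_eq_abs, abs_of_pos (by positivity), ← huw]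
      _ ≤ ‖u‖ / r * (δ + ‖Dc‖ * ρ) := mul_le_mul_of_nonneg_left hDw (by positivity)
      _ = (δ + ‖Dc‖ * ρ) / r * ‖u‖ := by ring
  have hop : ‖Dc‖ ≤ (δ + ‖Dc‖ * ρ) / r := ContinuousLinearMap.opNorm_le_bound _ (by positivity) key
  have hop' : ‖Dc‖ ≤ δ / (r - ρ) := by
    rw [le_div_iff₀ (by linarith)]
    have := (le_div_iff₀ hr).1 hop
    nlinarith
  calc ‖D v‖ = ‖Dc v‖ := rfl
    _ ≤ ‖Dc‖ * ‖v‖ := Dc.le_opNorm v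
    _ ≤ δ / (r - ρ) * ‖v‖ := mul_le_mul_of_nonneg_right hop' (norm_nonneg _)

end Summit.AtomisticToContinuum.Crystallization.Theorems.OverbindingBudgetAffineFarSmoothSplit
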